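import Literature.Topology.FourManifolds.BordismFourAssembly
import Literature.AlgebraicTopology.SingularHomology.BoundaryTransfer
import HarnessLib

/-!
# `isOrientedBordant_iff_signature_eq` without Spanier Thm. 6.3.5 / Cor. 6.3.10
(Layer 6 of `Literature.Topology.FourManifolds.isOrientedBordant_iff_signature_eq`)

Sibling proof file of `Literature.Topology.FourManifolds.BordismFourAssembly`.  There spc4.S36
(two closed oriented smooth 4-manifolds are oriented bordant iff their signatures agree; Thom 1954,
Thm IV.1 + Thm IV.13) was proved from nine named facts, two of which — Spanier Thm. 6.3.5
(`h635`, `relativeSingularHomology.exists_linearEquiv_of_ne_zero`) and Cor. 6.3.10 (`h6310`,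
`isGenerator_toLocal_δ_of_isRelFundamentalClass`) — served only to show, in the normalization of
a homological bordism datum (`exists_orientedSplitting`, `BordismFourOrientation.lean`), that the
transported class on the essential part `W'` of the cobordism is a relative fundamental class.
That step is now a theorem of `Literature`, proved locally for `C¹` manifolds with boundary
(`isRelFundamentalClass_of_isGenerator_toLocal_δ_of_isManifold`,
`…SingularHomology.BoundaryTransfer`; `W'` is an open subset of the smooth total space, hence
smooth), so both hypotheses disappear:

* `exists_orientedSplitting'` — `hA1` from the fundamental class of the ends alone (Hatcher
  Thm. 3.26, discharged: `isFundamentalClass_fundamentalClass_holds`);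
* `two_mul_boundaryImageRank_eq_of_duality` — Thom 1952 Cor. V.8 (`n = 4`, `p = 2`) from
  Lefschetz duality (`hL`, Spanier 6.3.12), finiteness for compact 5-manifolds with boundary
  (`hFW`, Spanier 6.2.21), Poincaré duality (`hD`, Hatcher 3.30) and finiteness of `H²`, `H₂`,
  `H₁` of closed 4-manifolds (`hF2`, `hF₂`, `hF₁`, Hatcher A.8–A.9);
* `signature_eq_of_isOrientedBordant_of_duality'` — Thom's Thm IV.1 in dimension four from those
  six inputs;
* `isOrientedBordant_iff_signature_eq_of_duality'` — spc4.S36 from the six inputs and Thom's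
  Thm IV.13 (`h₂`, `Ω⁴ ≅ ℤ` detected by the signature).  REMAINING HYPOTHESES: 7.

## References

* R. Thom, *Quelques propriétés globales des variétés différentiables*, Comment. Math. Helv. 28
  (1954), Thm IV.1 (p. 65), Thm IV.13 (p. 81). [ThomCMH1954]
* R. Thom, *Espaces fibrés en sphères et carrés de Steenrod*, Ann. Sci. ENS 69 (1952), Cor. V.8
  (p. 173). [Thom1952]
* A. Hatcher, *Algebraic Topology*, CUP 2002, Thm. 3.26, Thm. 3.30, Cor. A.8–A.9, §3.3 p. 252. [Hatcher2002]
* E. H. Spanier, *Algebraic Topology*, Springer 1981, Ch. 6 §2 Cor. 21, §3 Thm. 12. [Spanier1981]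
-/

noncomputable section

open scoped Manifold ContDiff Topology

universe u

namespace Literature.Topology.FourManifolds

section SPC4

/-- Every point of the essential part of a cobordism of positive-dimensional manifolds lies in
the connected component of a boundary point (from `exists_boundary_pair_essentialOpens`). [folklore] -/
theorem Cobordism.exists_boundary_mem_connectedComponent_essentialOpens {n : ℕ} (hn : n ≠ 0)
    {M N : Type u} [TopologicalSpace M] [ChartedSpace (EuclideanSpace ℝ (Fin n)) M]
    [TopologicalSpace N] [ChartedSpace (EuclideanSpace ℝ (Fin n)) N] (c : Cobordism n M N)
    (x : ↥c.essentialOpens) :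
    ∃ y ∈ (𝓡∂ (n + 1)).boundary ↥c.essentialOpens, y ∈ connectedComponent x := by
  obtain ⟨y, hy, -, -, -, hyx, -⟩ := c.exists_boundary_pair_essentialOpens hn x
  exact ⟨y, hy, hyx⟩

/-- **Normalization of an oriented-bordism datum without Spanier Thm. 6.3.5 / Cor. 6.3.10**
(hypothesis `hA1` of `two_mul_boundaryImageRank_eq_of_normalization`): as
`exists_orientedSplitting`, but the transported class on the essential part `W'` is shown to be
a relative fundamental class by the local theorem
`isRelFundamentalClass_of_isGenerator_toLocal_δ_of_isManifold` (`W'` is an open subset of the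
smooth total space `W`, hence a smooth 5-manifold with boundary; every component of `W'` meets
`∂W'`).  The only remaining input is the fundamental class of the closed oriented ends (`hμ`,
Hatcher Thm. 3.26). [cite: Hatcher2002, §3.3 Thm. 3.26 and p. 252] -/
theorem exists_orientedSplitting'
    (hμ : ∀ {P : Type u} [TopologicalSpace P],
      Literature.AlgebraicTopology.SingularHomology.HomologicalOrientation.isFundamentalClass_fundamentalClass (R := ℤ) (X := P) (n := 4))
    {M N : Type u} [TopologicalSpace M] [T2Space M] [SecondCountableTopology M]
    [ChartedSpace (EuclideanSpace ℝ (Fin 4)) M] [CompactSpace M] [IsManifold (𝓡 4) ∞ M]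
    [TopologicalSpace N] [T2Space N] [SecondCountableTopology N]
    [ChartedSpace (EuclideanSpace ℝ (Fin 4)) N] [CompactSpace N] [IsManifold (𝓡 4) ∞ N]
    (μ : Literature.AlgebraicTopology.SingularHomology.HomologicalOrientation ℤ M 4) (ν : Literature.AlgebraicTopology.SingularHomology.HomologicalOrientation ℤ N 4) (c : Cobordism 4 M N)
    (w : ↥(Literature.AlgebraicTopology.SingularHomology.relativeSingularHomology ℤ ℤ c.W ((𝓡∂ (4 + 1)).boundary c.W) (4 + 1)))
    (hw : Literature.AlgebraicTopology.SingularHomology.relativeSingularHomology.δ ℤ ℤ c.W ((𝓡∂ (4 + 1)).boundary c.W) 4 w =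
      Literature.AlgebraicTopology.SingularHomology.singularHomology.map ℤ ℤ c.inlBoundary 4 μ.fundamentalClass -
        Literature.AlgebraicTopology.SingularHomology.singularHomology.map ℤ ℤ c.inrBoundary 4 ν.fundamentalClass) :
    ∃ d : OrientedSplitting 4 M N μ ν, c.boundaryImageRank ℤ 2 = d.splitting.restrictRank ℤ 2 := by
  by_cases hB : ((𝓡∂ (4 + 1)).boundary c.W).Nonempty
  · obtain ⟨p₀, hp₀⟩ := hB
    set p : ↥c.essentialOpens := ⟨p₀, c.boundary_subset_essentialPart hp₀⟩
    have hδ := c.δ_collapseClass (R := ℤ) p w μ.fundamentalClass ν.fundamentalClass hw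
    refine ⟨OrientedSplitting.mk (↥c.essentialOpens) c.essentialSplitting (c.collapseClass p (4 + 1) w) hδ ?_,
      c.boundaryImageRank_eq_restrictRank_essentialSplitting p 2⟩
    have hinf : (∞ : WithTop ℕ∞) ≠ 0 := by simp
    exact Literature.AlgebraicTopology.SingularHomology.isRelFundamentalClass_of_isGenerator_toLocal_δ_of_isManifold
      (R := ℤ) hinf four_ne_zero _
      (c.essentialSplitting.isGenerator_toLocal_of_eq_sub μ ν (hμ μ) (hμ ν) _ hδ)
      (c.exists_boundary_mem_connectedComponent_essentialOpens four_ne_zero)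
  · have hB' : (𝓡∂ (4 + 1)).boundary c.W = ∅ := Set.not_nonempty_iff_eq_empty.mp hB
    haveI : IsEmpty M := ⟨fun m => hB ⟨c.inl m, c.inl_mem_boundary m⟩⟩
    haveI : IsEmpty N := ⟨fun m => hB ⟨c.inr m, c.inr_mem_boundary m⟩⟩
    haveI : IsEmpty ↥c.essentialOpens := c.isEmpty_essentialOpens hB'
    have hZ := isZero_singularHomology_of_isEmpty ℤ ℤ (↥((𝓡∂ (4 + 1)).boundary ↥c.essentialOpens)) 4
    refine ⟨OrientedSplitting.mk (↥c.essentialOpens) c.essentialSplitting 0 ?_ (fun x => isEmptyElim x), ?_⟩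
    · exact (eq_zero_of_isZero ℤ hZ _).trans (eq_zero_of_isZero ℤ hZ _).symm
    · change c.boundaryImageRank ℤ 2 = c.essentialSplitting.restrictRank ℤ 2
      rw [c.boundaryImageRank_eq_zero_of_isEmpty ℤ 2, c.essentialSplitting.restrictRank_eq_zero_of_isEmpty ℤ 2]

/-- **The leaf `two_mul_boundaryImageRank_eq` (Thom 1952, Cor. V.8 for `n = 4`, `p = 2`) from
duality and finiteness alone**: Lefschetz duality (`hL`, Spanier Thm. 6.3.12) and finiteness
(`hFW`, Spanier Cor. 6.2.21) for compact 5-manifolds with boundary, Poincaré duality (`hD`,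
Hatcher Thm. 3.30) and finiteness of `H²`, `H₂`, `H₁` (`hF2`, `hF₂`, `hF₁`, Hatcher Cor. A.8–A.9)
for closed 4-manifolds.  Universal coefficients, the fundamental classes of the ends and the
normalization of the bordism datum are theorems.  PROVED. [cite: Thom1952, Cor. V.8 (p. 173)] -/
theorem two_mul_boundaryImageRank_eq_of_duality
    (hL : ∀ {W : Type u} [TopologicalSpace W] [T2Space W] [CompactSpace W]
      [ChartedSpace (EuclideanHalfSpace (4 + 1)) W]
      (z : ↥(Literature.AlgebraicTopology.SingularHomology.relativeSingularHomology ℤ ℤ W ((𝓡∂ (4 + 1)).boundary W) (4 + 1)))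
      (hz : Literature.AlgebraicTopology.SingularHomology.IsRelFundamentalClass ℤ ((𝓡∂ (4 + 1)).boundary W) z),
      Literature.AlgebraicTopology.SingularHomology.bijective_relCapProduct_of_isRelFundamentalClass ℤ 4 W z hz (show 2 + (2 + 1) = 4 + 1 by rfl))
    (hFW : ∀ {W : Type u} [TopologicalSpace W] [T2Space W] [CompactSpace W]
      [ChartedSpace (EuclideanHalfSpace (4 + 1)) W]
      (z : ↥(Literature.AlgebraicTopology.SingularHomology.relativeSingularHomology ℤ ℤ W ((𝓡∂ (4 + 1)).boundary W) (4 + 1)))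
      (hz : Literature.AlgebraicTopology.SingularHomology.IsRelFundamentalClass ℤ ((𝓡∂ (4 + 1)).boundary W) z),
      Literature.AlgebraicTopology.SingularHomology.finite_singularHomology_of_isRelFundamentalClass ℤ 4 W z hz 2)
    (hD : ∀ {P : Type u} [TopologicalSpace P] [T2Space P] [CompactSpace P]
      [ChartedSpace (EuclideanSpace ℝ (Fin 4)) P] (π : Literature.AlgebraicTopology.SingularHomology.HomologicalOrientation ℤ P 4),
      Literature.AlgebraicTopology.SingularHomology.bijective_poincareDualityMap π two_add_two_eq_four)
    (hF2 : ∀ {P : Type u} [TopologicalSpace P] [T2Space P] [CompactSpace P]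
      [ChartedSpace (EuclideanSpace ℝ (Fin 4)) P], Literature.AlgebraicTopology.SingularHomology.finite_singularCohomology_of_compactSpace ℤ P 4 2)
    (hF₂ : ∀ {P : Type u} [TopologicalSpace P] [T2Space P] [CompactSpace P]
      [ChartedSpace (EuclideanSpace ℝ (Fin 4)) P], Literature.AlgebraicTopology.SingularHomology.finite_singularHomology_of_compactSpace ℤ P 4 2)
    (hF₁ : ∀ {P : Type u} [TopologicalSpace P] [T2Space P] [CompactSpace P]
      [ChartedSpace (EuclideanSpace ℝ (Fin 4)) P], Literature.AlgebraicTopology.SingularHomology.finite_singularHomology_of_compactSpace ℤ P 4 1) :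
    two_mul_boundaryImageRank_eq.{u} :=
  two_mul_boundaryImageRank_eq_of_normalization
    (fun μ ν c w hw => exists_orientedSplitting'
      (fun {P} _ => Literature.AlgebraicTopology.SingularHomology.HomologicalOrientation.isFundamentalClass_fundamentalClass_holds (R := ℤ) (X := P) 4)
      μ ν c w hw)
    hL hFW
    (fun {W} _ => Literature.AlgebraicTopology.SingularHomology.kroneckerMap_surjective_holds ℤ W 2)
    (fun {X} _ => @Literature.AlgebraicTopology.SingularHomology.ker_kroneckerMap_le_torsion_holds ℤ _ _ _ X _ 1)
    hD hF2 hF₂ hF₁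

/-- **Thom's Thm IV.1 in dimension four (bordism invariance of the signature) from duality and
finiteness alone** (six inputs: `hL`, `hFW`, `hD`, `hF2`, `hF₂`, `hF₁`).  PROVED.
[cite: ThomCMH1954, Thm IV.1 (p. 65)] -/
theorem signature_eq_of_isOrientedBordant_of_duality'
    (hL : ∀ {W : Type u} [TopologicalSpace W] [T2Space W] [CompactSpace W]
      [ChartedSpace (EuclideanHalfSpace (4 + 1)) W]
      (z : ↥(Literature.AlgebraicTopology.SingularHomology.relativeSingularHomology ℤ ℤ W ((𝓡∂ (4 + 1)).boundary W) (4 + 1)))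
      (hz : Literature.AlgebraicTopology.SingularHomology.IsRelFundamentalClass ℤ ((𝓡∂ (4 + 1)).boundary W) z),
      Literature.AlgebraicTopology.SingularHomology.bijective_relCapProduct_of_isRelFundamentalClass ℤ 4 W z hz (show 2 + (2 + 1) = 4 + 1 by rfl))
    (hFW : ∀ {W : Type u} [TopologicalSpace W] [T2Space W] [CompactSpace W]
      [ChartedSpace (EuclideanHalfSpace (4 + 1)) W]
      (z : ↥(Literature.AlgebraicTopology.SingularHomology.relativeSingularHomology ℤ ℤ W ((𝓡∂ (4 + 1)).boundary W) (4 + 1)))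
      (hz : Literature.AlgebraicTopology.SingularHomology.IsRelFundamentalClass ℤ ((𝓡∂ (4 + 1)).boundary W) z),
      Literature.AlgebraicTopology.SingularHomology.finite_singularHomology_of_isRelFundamentalClass ℤ 4 W z hz 2)
    (hD : ∀ {P : Type u} [TopologicalSpace P] [T2Space P] [CompactSpace P]
      [ChartedSpace (EuclideanSpace ℝ (Fin 4)) P] (π : Literature.AlgebraicTopology.SingularHomology.HomologicalOrientation ℤ P 4),
      Literature.AlgebraicTopology.SingularHomology.bijective_poincareDualityMap π two_add_two_eq_four)
    (hF2 : ∀ {P : Type u} [TopologicalSpace P] [T2Space P] [CompactSpace P]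
      [ChartedSpace (EuclideanSpace ℝ (Fin 4)) P], Literature.AlgebraicTopology.SingularHomology.finite_singularCohomology_of_compactSpace ℤ P 4 2)
    (hF₂ : ∀ {P : Type u} [TopologicalSpace P] [T2Space P] [CompactSpace P]
      [ChartedSpace (EuclideanSpace ℝ (Fin 4)) P], Literature.AlgebraicTopology.SingularHomology.finite_singularHomology_of_compactSpace ℤ P 4 2)
    (hF₁ : ∀ {P : Type u} [TopologicalSpace P] [T2Space P] [CompactSpace P]
      [ChartedSpace (EuclideanSpace ℝ (Fin 4)) P], Literature.AlgebraicTopology.SingularHomology.finite_singularHomology_of_compactSpace ℤ P 4 1) :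
    signature_eq_of_isOrientedBordant.{u} :=
  signature_eq_of_isOrientedBordant_of_boundaryImageRank
    (two_mul_boundaryImageRank_eq_of_duality hL hFW hD hF2 hF₂ hF₁)
    (fun π => sigPos_add_sigNeg_intersectionForm_four_of_facts π (hD π)
      (Literature.AlgebraicTopology.SingularHomology.kroneckerMap_surjective_holds ℤ _ 2)
      (@Literature.AlgebraicTopology.SingularHomology.ker_kroneckerMap_le_torsion_holds ℤ _ _ _ _ _ 1) hF2 hF₁
      (Literature.AlgebraicTopology.SingularHomology.cupProduct_gradedComm_holds ℤ _))
    hF2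

/-- **spc4.S36 (`isOrientedBordant_iff_signature_eq`) from duality, finiteness and Thom's
Thm IV.13** — seven inputs: Lefschetz duality (`hL`, Spanier Thm. 6.3.12) and finiteness
(`hFW`, Spanier Cor. 6.2.21) for compact 5-manifolds with boundary; Poincaré duality (`hD`,
Hatcher Thm. 3.30) and finiteness of `H²`, `H₂`, `H₁` (Hatcher Cor. A.8–A.9) for closed
4-manifolds; and Thom's Thm IV.13 (`h₂`, `Ω⁴ ≅ ℤ` detected by the signature — the converse
direction).  Everything else in Thom's proof of Thm IV.1 — universal coefficients, graded
commutativity of `⌣`, fundamental classes, the normalization of homological bordism data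
(now including the relative fundamental class of the essential part), the duality ladder, the
isotropy of `A²`, Sylvester — is a theorem of `Literature`.  PROVED.
[cite: ThomCMH1954, Thm IV.1 (p. 65) and Thm IV.13 (p. 81)] -/
theorem isOrientedBordant_iff_signature_eq_of_duality'
    (hL : ∀ {W : Type u} [TopologicalSpace W] [T2Space W] [CompactSpace W]
      [ChartedSpace (EuclideanHalfSpace (4 + 1)) W]
      (z : ↥(Literature.AlgebraicTopology.SingularHomology.relativeSingularHomology ℤ ℤ W ((𝓡∂ (4 + 1)).boundary W) (4 + 1)))
      (hz : Literature.AlgebraicTopology.SingularHomology.IsRelFundamentalClass ℤ ((𝓡∂ (4 + 1)).boundary W) z),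
      Literature.AlgebraicTopology.SingularHomology.bijective_relCapProduct_of_isRelFundamentalClass ℤ 4 W z hz (show 2 + (2 + 1) = 4 + 1 by rfl))
    (hFW : ∀ {W : Type u} [TopologicalSpace W] [T2Space W] [CompactSpace W]
      [ChartedSpace (EuclideanHalfSpace (4 + 1)) W]
      (z : ↥(Literature.AlgebraicTopology.SingularHomology.relativeSingularHomology ℤ ℤ W ((𝓡∂ (4 + 1)).boundary W) (4 + 1)))
      (hz : Literature.AlgebraicTopology.SingularHomology.IsRelFundamentalClass ℤ ((𝓡∂ (4 + 1)).boundary W) z),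
      Literature.AlgebraicTopology.SingularHomology.finite_singularHomology_of_isRelFundamentalClass ℤ 4 W z hz 2)
    (hD : ∀ {P : Type u} [TopologicalSpace P] [T2Space P] [CompactSpace P]
      [ChartedSpace (EuclideanSpace ℝ (Fin 4)) P] (π : Literature.AlgebraicTopology.SingularHomology.HomologicalOrientation ℤ P 4),
      Literature.AlgebraicTopology.SingularHomology.bijective_poincareDualityMap π two_add_two_eq_four)
    (hF2 : ∀ {P : Type u} [TopologicalSpace P] [T2Space P] [CompactSpace P]
      [ChartedSpace (EuclideanSpace ℝ (Fin 4)) P], Literature.AlgebraicTopology.SingularHomology.finite_singularCohomology_of_compactSpace ℤ P 4 2)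
    (hF₂ : ∀ {P : Type u} [TopologicalSpace P] [T2Space P] [CompactSpace P]
      [ChartedSpace (EuclideanSpace ℝ (Fin 4)) P], Literature.AlgebraicTopology.SingularHomology.finite_singularHomology_of_compactSpace ℤ P 4 2)
    (hF₁ : ∀ {P : Type u} [TopologicalSpace P] [T2Space P] [CompactSpace P]
      [ChartedSpace (EuclideanSpace ℝ (Fin 4)) P], Literature.AlgebraicTopology.SingularHomology.finite_singularHomology_of_compactSpace ℤ P 4 1)
    (h₂ : isOrientedBordant_of_signature_eq.{u}) : isOrientedBordant_iff_signature_eq.{u} :=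
  isOrientedBordant_iff_signature_eq_of
    (signature_eq_of_isOrientedBordant_of_duality' hL hFW hD hF2 hF₂ hF₁) h₂

end SPC4

end Literature.Topology.FourManifolds

end
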